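import Summits.BirchSwinnertonDyer.Rank1Residual.Additive.TameBranchRatCharEqPotMultHeadlines
import Literature.NumberTheory.EllipticCurves.CyclotomicIwasawaMainTheoremIrreducibleProofs
import Literature.NumberTheory.EllipticCurves.PAdicLFunctionNonsplitMultiplicativeExistenceProofs
import HarnessLib

/-!
# Route `AdditiveBranchIMC` (rung K1), crux `MultLower` (item `stmt-BirchSwinnertonDyer-19359`):
# the BRANCH TRANSPORT on cell (M), typed and proved — "the Skinner–Urban lower half under base change"

Cell (M) of the additive potentially-ordinary locus: `E = W` globally minimal, `p` odd, ADDITIVE and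
potentially MULTIPLICATIVE at `p`; then `E = V ⊗ χ_{p*}` for a globally minimal `V = E♭` MULTIPLICATIVE
at `p` (`AdditivePotMult.ClassX4M/ClassX3M.exists_mult_pStar_twist_model`), and the Iwasawa module
`X(E/ℚ_∞)` is the `χ_{p*} = ω^{(p−1)/2}`-branch of `X(V/ℚ(μ_{p^∞}))`, its `p`-adic `L`-function the
`ω^{(p−1)/2}`-branch `L^±_p(f_V, a_p, ω^{(p−1)/2}, T)` of the ONE-term Mazur–Tate–Teitelbaum measure
of `f_V` (`padicLFunction{Plus,Minus}BranchMult`). The crux in rank `0` (`stub_rankZero` =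
the tree's conjecture `N10.LowerHalfM`) is, modulo published facts and a finite `μ = 0` certificate, the
main-conjecture containment `char_Λ X(E/ℚ_∞) ⊆ (L^±_br)` on THAT branch
(`ChiBranchRatCharEqMult[Odd]At`, `PotMultRatMainConjLowerBound[Odd].lean`); the printed lower-bound
theorems for `V` (Skinner, Pacific J. Math. 283 (2016) Thm. A; Skinner–Urban 2014 Thm. 3.6.4 /
Cor. 3.6.2–3.6.3) sit on the TRIVIAL branch `ω⁰` only.

WHAT DOES NOT TRANSPORT. The `ω⁰`- and `ω^{(p−1)/2}`-isotypic parts of `X(V/ℚ(μ_{p^∞}))` are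
orthogonal direct summands (`e_{ω⁰}·Λ[Δ]·e_χ = 0`, `p ∤ #Δ`): a statement about `e_{ω⁰}X` and the
interpolation formula of the two-variable measure carry NO information on `e_χ X`. "IMC on `ω⁰` +
interpolation of the `χ_{p*}`-twisted values ⇒ `⊆ (𝓛)` on `ω^{(p−1)/2}`" is therefore not a lemma; it
is the crux restated. No `𝓛`-invariant enters at `T = 0` on the `χ`-branch either: `χ_{p*}` is
RAMIFIED at `p`, the interpolation factor at `χ` is `p/(α τ(χ))`, never `1 − α⁻¹`
(`constantCoeff_padicLFunctionPlusBranchMult_half`); the exceptional zero of a split `V` lives in `V`'s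
own factor and is carried below as `X^e`, `e = 1` (split) / `0` (non-split) — nothing is divided by `T`.

WHAT DOES TRANSPORT (this file) — the base-change squeeze of Burungale–Castella–Skinner, IMRN 2025
Thm. 1.1.2 (a), proof p. 10 ("a proper divisibility in (5.4) would contradict (5.3)"), with the
two-member family `{V, V^{(p*)} = E}` in place of their four twists: over `K = ℚ(√p*)` one has
`X(V/K·ℚ_∞) ≅ X(V/ℚ_∞) ⊕ X(E/ℚ_∞)` (`p` odd; tree bricks `PrimeToPDescent`, `twistDescentEquiv`) and
`L_p(V/K) = L_p(V)·L^±_br`, so a main-conjecture LOWER bound for `V` over the cyclotomic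
`ℤ_p`-extension of `K` descends (Skinner–Urban Props. 3.6/3.9 / Cor. 3.2.9 shape) to the PRODUCT
containment
  (BC)  `p^m · char X(V/ℚ_∞) · char X(E/ℚ_∞) ⊆ (G)`, `ι(X^e·G) = p^n · L_p(V,T) · L^±_br(T)`,
and then: Kato's divisibility for `V` on `ω⁰` (KV) + Kato's divisibility for `E` = the `χ`-branch
(KE: IN THE TREE on X4(M) ∩ {ρ̄ onto} from Kato 2004 Thm. 17.4 (3) via
`AdditivePotMult.isTorsion_and_exists_iota_eq_of_katoHalf`, and on X3♯(M) from Wuthrich 2014 Thm. 16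
via `…_of_wuthrichHalf`) + (BC) ⟹ BOTH rational equalities, in particular the `χ`-branch one
(`ChiBranchRatCharEqMult[Odd]At W p`). Theorems:

* §1 `exists_span_eq_of_katoPair_of_prod_mem` — the two-member algebra in `Λ = ℤ_p⟦T⟧`
  (instance of the tree's `exists_span_eq_and_map_eq_C_zpow_mul_of_prod_mem`);
* §2 `charIdeal_eq_span_of_katoPair_of_baseChangeLower` — per datum: (KV) ∧ (KE) ∧ (BC) ⟹
  `char X(E/ℚ_∞) = (g)`, `ι g = p^k·L_E` AND `char X(V/ℚ_∞) = (g')`, `ι(X^e g') = p^{k'}·L_V`;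
* §3 `charIdeal_eq_span_branchMult_of_brick_of_katoV_of_baseChangeLower` — the (M) dictionary (period
  ratio `ϖ` and the unit of the E-side brick absorbed) and
  `isTorsion_and_charIdeal_eq_span_branchMult_of_katoV_of_baseChangeLower` — per twist-model datum, from
  the OUTPUT of the tree's E-side brick, (KV) and (BC): the conclusion shape of
  `ChiBranchRatCharEqMult[Odd]At`. The CLASS theorems (X4(M) ∩ {ρ̄ onto} via Kato 17.4 (3), X3♯(M) via
  Wuthrich Thm. 16) and the rank-`0` lower half are in the sequel
  `AdditiveBranchIMCMultLowerBranchTransportClasses.lean`.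

LITERATURE STATE of the displayed inputs (nothing asserted here). (KV): Kato 2004 Thm. 17.4 / Skinner
2016 Thm. A on the (irr)+(ram) rows of `V` (tree fact `Skinner2016.thmA_charIdeal_multiplicative`).
(BC): NOT IN PRINT — `p ∣ d_K` for `K = ℚ(√p*)`: Wan 2015 needs `p` unramified in the totally real
field; Skinner–Urban Thms. 3.6.1/3.6.6 and Wan's `U(3,1)` divisibility need `p` split in the CM field;
Burungale–Castella–Skinner Lemma 5.2.3 CHOOSES fields with `p` split/unramified; BSTW arXiv:2409.01350
Thm. 9.21 (c) needs `p ∤ 6N_g`. (BC) is the ONE typed Λ-level object this transport leaves for cell (M):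
the shape a base-change main-conjecture theorem at a prime RAMIFIED in the quadratic field delivers.
No definition, no named fact, no `sorry`; every published input is a hypothesis BY NAME.

References: Burungale–Castella–Skinner, IMRN 2025 rnaf082 = arXiv:2405.00270v2, Thm. 1.1.2 (a), §5
(5.3)–(5.4) [BurungaleCastellaSkinner2025]; Skinner, Pacific J. Math. 283 (2016) Thm. A, §3.2
[Skinner2016PacificMC]; Skinner–Urban, Invent. Math. 195 (2014) Thm. 3.6.4, Cor. 3.2.9, Props. 3.6/3.9
[SkinnerUrban2014]; Kato, Astérisque 295 (2004) Thm. 17.4 (3) [Kato2004Asterisque]; Wuthrich, Doc.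
Math. 19 (2014) Thm. 16 [Wuthrich2014]; Mazur–Tate–Teitelbaum, Invent. Math. 84 (1986) §I.10,
§I.13–I.14 [MazurTateTeitelbaum1986Invent]; Delbourgo, Compositio Math. 113 (1998) Main Conjecture
p. 151 [Delbourgo1998]; Wan, Algebra Number Theory 9 (2015) §1.1 [Wan2015HilbertIMC].
-/

set_option autoImplicit false
set_option linter.dupNamespace false

noncomputable section

open scoped Classical MatrixGroups ModularForm

namespace Summit.BirchSwinnertonDyer.BirchSwinnertonDyer.Theorems.AdditiveBranchIMCMultLower

open CongruenceSubgroup WeierstrassCurve Literature.NumberTheory.EllipticCurves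
  Literature.NumberTheory.EllipticCurves.ModularForms
  Literature.NumberTheory.EllipticCurves.Rank1Residual
  Summit.BirchSwinnertonDyer.Rank1Residual.Additive
  Summit.BirchSwinnertonDyer.Rank1Residual.AdditivePotMult

variable (p : ℕ) [hp : Fact p.Prime]

/-! ### §1 The two-member squeeze in `Λ = ℤ_p⟦T⟧` (Burungale–Castella–Skinner (5.3) + (5.4), `s = {V, E}`) -/
/-- **No proper divisibility in a two-member product** (Burungale–Castella–Skinner, IMRN 2025, proof
of Thm. 1.1.2 (a), p. 10 of arXiv:2405.00270v2, with `s = {V, E}`). In `Λ = ℤ_p⟦T⟧` with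
`ι : Λ ↪ ℚ_p⟦T⟧`: if `gV, gE ≠ 0`, Kato's inclusions hold for both members — `hV ∈ (gV)` with
`ι hV = p^a · LV` and `hE ∈ (gE)` with `ι hE = p^b · LE` — and the PRODUCT inclusion holds —
`p^m · gV · gE ∈ (G)` with `ι G = p^n · LV · LE` — then `(gE) = (g')` with `ι g' = p^k · LE` and
`(gV) = (g'')` with `ι g'' = p^{k'} · LV` (`k, k' ∈ ℤ`): the rational main conjecture for EACH member.
The `Bool`-indexed instance of the tree's `exists_span_eq_and_map_eq_C_zpow_mul_of_prod_mem`.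
[cite: BurungaleCastellaSkinner2025, Proof of Thm. 1.1.2 (a) (arXiv:2405.00270v2 p. 10)] -/
theorem exists_span_eq_of_katoPair_of_prod_mem
    {gV gE hV hE G : IwasawaAlgebra p} {LV LE : PowerSeries ℚ_[p]} {a b m n : ℕ}
    (hgV0 : gV ≠ 0) (hgE0 : gE ≠ 0)
    (hhV : hV ∈ Ideal.span {gV})
    (hιV : iwasawaToPowerSeries p hV = PowerSeries.C ((p : ℚ_[p]) ^ a) * LV)
    (hhE : hE ∈ Ideal.span {gE})
    (hιE : iwasawaToPowerSeries p hE = PowerSeries.C ((p : ℚ_[p]) ^ b) * LE)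
    (hG : PowerSeries.C ((p : ℤ_[p]) ^ m) * (gV * gE) ∈ Ideal.span {G})
    (hιG : iwasawaToPowerSeries p G = PowerSeries.C ((p : ℚ_[p]) ^ n) * (LV * LE)) :
    (∃ (g' : IwasawaAlgebra p) (k : ℤ), Ideal.span {gE} = Ideal.span {g'} ∧
        iwasawaToPowerSeries p g' = PowerSeries.C ((p : ℚ_[p]) ^ k) * LE) ∧
      ∃ (g' : IwasawaAlgebra p) (k : ℤ), Ideal.span {gV} = Ideal.span {g'} ∧
        iwasawaToPowerSeries p g' = PowerSeries.C ((p : ℚ_[p]) ^ k) * LV := by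
  -- the two-member family indexed by `Bool`: `true ↦ V`, `false ↦ E`
  let g : Bool → IwasawaAlgebra p := fun i => bif i then gV else gE
  let g₁ : Bool → IwasawaAlgebra p := fun i => bif i then hV else hE
  let L : Bool → PowerSeries ℚ_[p] := fun i => bif i then LV else LE
  let c : Bool → ℕ := fun i => bif i then a else b
  have hg0 : ∀ i ∈ (Finset.univ : Finset Bool), g i ≠ 0 := by
    rintro (_ | _) -
    · exact hgE0
    · exact hgV0
  have hg₁ : ∀ i ∈ (Finset.univ : Finset Bool), g₁ i ∈ Ideal.span {g i} := by
    rintro (_ | _) -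
    · exact hhE
    · exact hhV
  have hιg₁ : ∀ i ∈ (Finset.univ : Finset Bool),
      iwasawaToPowerSeries p (g₁ i) = PowerSeries.C ((p : ℚ_[p]) ^ c i) * L i := by
    rintro (_ | _) -
    · exact hιE
    · exact hιV
  have hG' : PowerSeries.C ((p : ℤ_[p]) ^ m) * ∏ i ∈ (Finset.univ : Finset Bool), g i ∈
      Ideal.span {G} := by
    have : ∏ i ∈ (Finset.univ : Finset Bool), g i = gV * gE := by
      rw [Fintype.prod_bool]; rfl
    rw [this]; exact hG
  have hιG' : iwasawaToPowerSeries p G =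
      PowerSeries.C ((p : ℚ_[p]) ^ n) * ∏ i ∈ (Finset.univ : Finset Bool), L i := by
    have : ∏ i ∈ (Finset.univ : Finset Bool), L i = LV * LE := by
      rw [Fintype.prod_bool]; rfl
    rw [this]; exact hιG
  refine ⟨?_, ?_⟩
  · obtain ⟨g', k, h1, h2⟩ := exists_span_eq_and_map_eq_C_zpow_mul_of_prod_mem p hg0 hg₁ hιg₁ hG'
      hιG' (Finset.mem_univ false)
    exact ⟨g', k, h1, h2⟩
  · obtain ⟨g', k, h1, h2⟩ := exists_span_eq_and_map_eq_C_zpow_mul_of_prod_mem p hg0 hg₁ hιg₁ hG'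
      hιG' (Finset.mem_univ true)
    exact ⟨g', k, h1, h2⟩


/-- **A nonzero rational is `p^v` times a `p`-adic unit** (`v = ord_p r`). Bookkeeping used to absorb
period ratios into the exponent of the rational main conjecture. [folklore] -/
theorem exists_zpow_mul_units_eq_ratCast {r : ℚ} (hr0 : r ≠ 0) :
    ∃ (v : ℤ) (w : ℤ_[p]ˣ), ((r : ℚ) : ℚ_[p]) = (p : ℚ_[p]) ^ v * ((w : ℤ_[p]) : ℚ_[p]) := by
  have hrQ : ((r : ℚ) : ℚ_[p]) ≠ 0 := by exact_mod_cast hr0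
  have hp0 : (p : ℚ_[p]) ≠ 0 := Nat.cast_ne_zero.mpr hp.out.ne_zero
  set v : ℤ := padicValRat p r with hv
  have hnorm : ‖((r : ℚ) : ℚ_[p]) * (p : ℚ_[p]) ^ (-v)‖ = 1 := by
    rw [norm_mul, Padic.norm_p_zpow, Padic.norm_eq_zpow_neg_valuation hrQ,
      Padic.valuation_ratCast, ← hv, neg_neg, ← zpow_add₀ (by exact_mod_cast hp.out.ne_zero),
      neg_add_cancel, zpow_zero]
  refine ⟨v, PadicInt.mkUnits hnorm, ?_⟩
  rw [PadicInt.mkUnits_eq hnorm, mul_comm, mul_assoc, ← zpow_add₀ hp0, neg_add_cancel, zpow_zero,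
    mul_one]

/-! ### §2 Per datum: (KV) ∧ (KE) ∧ (BC) ⟹ the rational main conjecture for BOTH members -/
/-- **Per datum: Kato for `V` on the trivial branch (KV) ∧ Kato for `E` (KE) ∧ the base-change
product bound (BC) ⟹ the rational main conjecture for `E` AND for `V`.** `DV`, `DE` are Pontryagin-dual
data of `Sel_{p^∞}(V/ℚ_∞)`, `Sel_{p^∞}(E/ℚ_∞)` for the same cyclotomic datum; `LV, LE ∈ ℚ_p⟦T⟧` ANY
power series (the intended ones: `L_p(V,T)` of `IsMultPAdicLFunctionOf` and `ϖ·L^±_br`); `e ∈ ℕ` the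
exceptional exponent of `V` (`1` at a split multiplicative `p`, where `char` of the STRICT Selmer dual is
`(L_p(V,T)/T)`, Skinner 2016 §3.2; `0` otherwise) — carried as `X^e` on `V`'s side so that nothing is
divided by `T`. Conclusion: `char X(E/ℚ_∞) = (g)`, `ι g = p^k · LE`, and `char X(V/ℚ_∞) = (g')`,
`ι(X^e g') = p^{k'} · LV`. Characteristic ideals are principal (`charIdeal_isPrincipal_holds`) and nonzero
(`Module.charIdeal_ne_bot`); the algebra is §1 with `gV := X^e · c_V`.
[cite: BurungaleCastellaSkinner2025, Proof of Thm. 1.1.2 (a) (arXiv:2405.00270v2 p. 10)]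
[cite: Skinner2016PacificMC, §3.2 (the exceptional factor of the strict Selmer group)] -/
theorem charIdeal_eq_span_of_katoPair_of_baseChangeLower
    {V W : WeierstrassCurve ℚ} {κ : ZpExtension ℚ p} {γ : Field.absoluteGaloisGroup ℚ}
    (DV : V.SelmerDualData κ γ) (DE : W.SelmerDualData κ γ) (e : ℕ) {LV LE : PowerSeries ℚ_[p]}
    (hKV : ∃ (a : ℕ) (h : IwasawaAlgebra p), h ∈ DV.charIdeal ∧
      iwasawaToPowerSeries p (PowerSeries.X ^ e * h) = PowerSeries.C ((p : ℚ_[p]) ^ a) * LV)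
    (hKE : ∃ (b : ℕ) (h : IwasawaAlgebra p), h ∈ DE.charIdeal ∧
      iwasawaToPowerSeries p h = PowerSeries.C ((p : ℚ_[p]) ^ b) * LE)
    (hBC : ∃ (m n : ℕ) (G : IwasawaAlgebra p),
      iwasawaToPowerSeries p (PowerSeries.X ^ e * G) =
          PowerSeries.C ((p : ℚ_[p]) ^ n) * (LV * LE) ∧
        ∀ x ∈ DV.charIdeal, ∀ y ∈ DE.charIdeal,
          PowerSeries.C ((p : ℤ_[p]) ^ m) * (x * y) ∈ Ideal.span {G}) :
    (∃ (g : IwasawaAlgebra p) (k : ℤ), DE.charIdeal = Ideal.span {g} ∧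
        iwasawaToPowerSeries p g = PowerSeries.C ((p : ℚ_[p]) ^ k) * LE) ∧
      ∃ (g : IwasawaAlgebra p) (k : ℤ), DV.charIdeal = Ideal.span {g} ∧
        iwasawaToPowerSeries p (PowerSeries.X ^ e * g) = PowerSeries.C ((p : ℚ_[p]) ^ k) * LV := by
  -- generators of the (principal, nonzero) characteristic ideals
  haveI : (Module.charIdeal (IwasawaAlgebra p) DV.X).IsPrincipal := charIdeal_isPrincipal_holds p DV.X
  haveI : (Module.charIdeal (IwasawaAlgebra p) DE.X).IsPrincipal := charIdeal_isPrincipal_holds p DE.X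
  obtain ⟨cV, hcV⟩ := Submodule.IsPrincipal.principal (Module.charIdeal (IwasawaAlgebra p) DV.X)
  obtain ⟨cE, hcE⟩ := Submodule.IsPrincipal.principal (Module.charIdeal (IwasawaAlgebra p) DE.X)
  have hV : DV.charIdeal = Ideal.span {cV} := hcV
  have hE : DE.charIdeal = Ideal.span {cE} := hcE
  have hcV0 : cV ≠ 0 := fun h0 => Module.charIdeal_ne_bot (IwasawaAlgebra p) DV.X (by
    change DV.charIdeal = ⊥; rw [hV, h0, Ideal.span_singleton_eq_bot])
  have hcE0 : cE ≠ 0 := fun h0 => Module.charIdeal_ne_bot (IwasawaAlgebra p) DE.X (by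
    change DE.charIdeal = ⊥; rw [hE, h0, Ideal.span_singleton_eq_bot])
  have hX0 : (PowerSeries.X : IwasawaAlgebra p) ^ e ≠ 0 := pow_ne_zero _ PowerSeries.X_ne_zero
  -- the member `V` enters with the generator `X^e · cV`
  obtain ⟨a, hV', hhV', hιV⟩ := hKV
  obtain ⟨b, hE', hhE', hιE⟩ := hKE
  obtain ⟨m, n, G, hιG, hG⟩ := hBC
  rw [hV] at hhV'
  rw [hE] at hhE'
  obtain ⟨t, ht⟩ := Ideal.mem_span_singleton'.mp hhV'
  have hmemV : PowerSeries.X ^ e * hV' ∈ Ideal.span {PowerSeries.X ^ e * cV} :=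
    Ideal.mem_span_singleton'.mpr ⟨t, by rw [← ht]; ring⟩
  have hGmem : PowerSeries.C ((p : ℤ_[p]) ^ m) * (PowerSeries.X ^ e * cV * cE) ∈
      Ideal.span {PowerSeries.X ^ e * G} := by
    obtain ⟨r, hr⟩ := Ideal.mem_span_singleton'.mp
      (hG cV (by rw [hV]; exact Ideal.mem_span_singleton_self _) cE
        (by rw [hE]; exact Ideal.mem_span_singleton_self _))
    exact Ideal.mem_span_singleton'.mpr ⟨r, by
      calc r * (PowerSeries.X ^ e * G) = PowerSeries.X ^ e * (r * G) := by ring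
        _ = PowerSeries.X ^ e * (PowerSeries.C ((p : ℤ_[p]) ^ m) * (cV * cE)) := by rw [hr]
        _ = PowerSeries.C ((p : ℤ_[p]) ^ m) * (PowerSeries.X ^ e * cV * cE) := by ring⟩
  obtain ⟨⟨g', k, hspanE, hιE'⟩, ⟨g'', k', hspanV, hιV'⟩⟩ :=
    exists_span_eq_of_katoPair_of_prod_mem p (mul_ne_zero hX0 hcV0) hcE0 hmemV hιV hhE' hιE hGmem hιG
  refine ⟨⟨g', k, hE.trans hspanE, hιE'⟩, ?_⟩
  -- `(X^e · cV) = (g'')` ⇒ `g'' = X^e · cV · u` for a unit `u`; take `g := cV · u`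
  obtain ⟨u, hu⟩ := Ideal.span_singleton_eq_span_singleton.mp hspanV
  refine ⟨cV * u, k', ?_, ?_⟩
  · rw [hV, Ideal.span_singleton_mul_right_unit u.isUnit]
  · rw [← hιV', ← hu]; ring_nf


/-! ### §3 Cell (M): the dictionary, per datum -/
/-- **(M) dictionary, per datum.** `W = E` additive at the odd `p`, `V` a twist model multiplicative at
`p`, `f` a newform of `V`, `ϖ ≠ 0` a period ratio, `D`/`DV` cyclotomic dual data of `E`/`V`, `L` any power
series (intended `L_p(V,T)`), `Lbr` any power series (intended `L^±_p(f, a_p, ω^{(p−1)/2}, T)`), `e ∈ ℕ`: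
the E-side brick in its native INTEGRAL shape — `g ∈ char X(E/ℚ_∞)` with `ι g = u·ϖ·Lbr`, `u ∈ ℤ_p^×`
(`AdditivePotMult.isTorsion_and_exists_iota_eq_of_katoHalf / _of_wuthrichHalf`) — together with (KV) and
(BC) gives `char X(E/ℚ_∞) = (g')` with `ι g' = p^k·ϖ·Lbr` (the conclusion shape of
`ChiBranchRatCharEqMult[Odd]At`) and `char X(V/ℚ_∞) = (g'')` with `ι(X^e g'') = p^{k'}·L`. The period
ratio is absorbed by `ϖ = p^v·w`, `w ∈ ℤ_p^×` (`exists_zpow_mul_units_eq_ratCast`).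
[cite: BurungaleCastellaSkinner2025, Proof of Thm. 1.1.2 (a) (arXiv:2405.00270v2 p. 10)]
[cite: MazurTateTeitelbaum1986Invent, §I.10, §I.13–I.14 (the branch series; shape)] -/
theorem charIdeal_eq_span_branchMult_of_brick_of_katoV_of_baseChangeLower
    {V W : WeierstrassCurve ℚ} {κ : ZpExtension ℚ p} {γ : Field.absoluteGaloisGroup ℚ}
    (DV : V.SelmerDualData κ γ) (D : W.SelmerDualData κ γ) (e : ℕ) {L Lbr : PowerSeries ℚ_[p]}
    {ϖ : ℚ} (hϖ0 : ϖ ≠ 0)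
    (hKE : ∃ g ∈ D.charIdeal, ∃ u : ℤ_[p]ˣ,
      iwasawaToPowerSeries p g = PowerSeries.C (((u : ℤ_[p]) : ℚ_[p]) * (ϖ : ℚ_[p])) * Lbr)
    (hKV : ∃ (a : ℕ) (h : IwasawaAlgebra p), h ∈ DV.charIdeal ∧
      iwasawaToPowerSeries p (PowerSeries.X ^ e * h) = PowerSeries.C ((p : ℚ_[p]) ^ a) * L)
    (hBC : ∃ (m n : ℕ) (G : IwasawaAlgebra p),
      iwasawaToPowerSeries p (PowerSeries.X ^ e * G) = PowerSeries.C ((p : ℚ_[p]) ^ n) * (L * Lbr) ∧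
        ∀ x ∈ DV.charIdeal, ∀ y ∈ D.charIdeal,
          PowerSeries.C ((p : ℤ_[p]) ^ m) * (x * y) ∈ Ideal.span {G}) :
    (∃ (g : IwasawaAlgebra p) (k : ℤ), D.charIdeal = Ideal.span {g} ∧
        iwasawaToPowerSeries p g = PowerSeries.C ((p : ℚ_[p]) ^ k * (ϖ : ℚ_[p])) * Lbr) ∧
      ∃ (g : IwasawaAlgebra p) (k : ℤ), DV.charIdeal = Ideal.span {g} ∧
        iwasawaToPowerSeries p (PowerSeries.X ^ e * g) = PowerSeries.C ((p : ℚ_[p]) ^ k) * L := by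
  have hp0 : (p : ℚ_[p]) ≠ 0 := Nat.cast_ne_zero.mpr hp.out.ne_zero
  obtain ⟨v, w, hvw⟩ := exists_zpow_mul_units_eq_ratCast p hϖ0
  have hιC : ∀ (c : ℤ_[p]) (x : IwasawaAlgebra p), iwasawaToPowerSeries p (PowerSeries.C c * x) =
      PowerSeries.C ((c : ℤ_[p]) : ℚ_[p]) * iwasawaToPowerSeries p x := fun c x ↦ by
    rw [map_mul]
    simp only [iwasawaToPowerSeries, PowerSeries.map_C, PadicInt.algebraMap_apply]
  -- (KE) in the `p^b · Lbr` shape: multiply the brick's `g` by the unit `(u w)⁻¹` and by `p^{(-v)⁺}`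
  obtain ⟨g, hg, u, hιg⟩ := hKE
  have hunit : ((((u * w)⁻¹ : ℤ_[p]ˣ) : ℤ_[p]) : ℚ_[p]) * (((u : ℤ_[p]) : ℚ_[p]) *
      ((w : ℤ_[p]) : ℚ_[p])) = 1 := by
    rw [← PadicInt.coe_mul, ← PadicInt.coe_mul, ← Units.val_mul, Units.inv_mul]
    simp
  have hKE' : ∃ (b : ℕ) (h : IwasawaAlgebra p), h ∈ D.charIdeal ∧
      iwasawaToPowerSeries p h = PowerSeries.C ((p : ℚ_[p]) ^ b) * Lbr := by
    refine ⟨v.toNat, PowerSeries.C ((((u * w)⁻¹ : ℤ_[p]ˣ) : ℤ_[p]) * (p : ℤ_[p]) ^ (-v).toNat) * g,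
      Ideal.mul_mem_left _ _ hg, ?_⟩
    have hvv : ((v.toNat : ℕ) : ℤ) = v + ((-v).toNat : ℕ) := by omega
    have hpow : (p : ℚ_[p]) ^ v.toNat = (p : ℚ_[p]) ^ v * (p : ℚ_[p]) ^ (-v).toNat := by
      rw [← zpow_natCast, hvv, zpow_add₀ hp0, zpow_natCast]
    have hscal : ((((u * w)⁻¹ : ℤ_[p]ˣ) : ℤ_[p]) : ℚ_[p]) * (p : ℚ_[p]) ^ (-v).toNat *
        (((u : ℤ_[p]) : ℚ_[p]) * ((p : ℚ_[p]) ^ v * ((w : ℤ_[p]) : ℚ_[p]))) =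
        (p : ℚ_[p]) ^ v * (p : ℚ_[p]) ^ (-v).toNat := by
      linear_combination ((p : ℚ_[p]) ^ v * (p : ℚ_[p]) ^ (-v).toNat) * hunit
    rw [hιC, hιg, ← mul_assoc, ← map_mul, hvw, hpow]
    push_cast
    rw [hscal]
  obtain ⟨⟨g', k, hspan, hι'⟩, hVside⟩ :=
    charIdeal_eq_span_of_katoPair_of_baseChangeLower p DV D e hKV hKE' hBC
  refine ⟨⟨PowerSeries.C (w : ℤ_[p]) * g', k - v, ?_, ?_⟩, hVside⟩
  · rw [hspan, Ideal.span_singleton_mul_left_unit ((w.isUnit).map PowerSeries.C)]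
  · have hscal' : ((w : ℤ_[p]) : ℚ_[p]) * (p : ℚ_[p]) ^ k =
        (p : ℚ_[p]) ^ (k - v) * ((p : ℚ_[p]) ^ v * ((w : ℤ_[p]) : ℚ_[p])) := by
      rw [zpow_sub₀ hp0]
      field_simp
    rw [hιC, hι', ← mul_assoc, ← map_mul, hvw, hscal']


/-- **(M), per datum, from the E-side BRICK.** `V/ℚ` multiplicative at `p` (a twist model of the
additive `E = W`), `f` a newform of `V` with `a_p(f) = ap`, cyclotomic `κ, γ`, `D` a dual datum of
`Sel_{p^∞}(E/ℚ_∞)`, `ϖ` the period ratio of the parity of `(p−1)/2`, and `hbrick` the OUTPUT of the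
tree's E-side brick at this datum (`AdditivePotMult.isTorsion_and_exists_iota_eq_of_katoHalf` on
X4(M) ∩ {ρ̄ onto} from Kato 2004 Thm. 17.4 (3), `…_of_wuthrichHalf` on X3♯(M) from Wuthrich 2014 Thm. 16:
`g ∈ char X(E/ℚ_∞)`, `ι g = u·ϖ·B` for the branch `B` of the three-way reduction disjunction).
Displayed inputs AT THIS DATUM: (KV) for every dual datum of `V` and the `p`-adic `L`-function
`L_p(V,T)` of `IsMultPAdicLFunctionOf f p a_p` (strict Selmer group: exceptional factor `X^e`, `e = 1`
iff `V` is split at `p`), and (BC). Conclusion: `X(E/ℚ_∞)` is torsion and `char X(E/ℚ_∞) = (g)`,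
`ι g = p^k · ϖ · L^±_p(f, a_p, ω^{(p−1)/2}, T)`. The `p`-adic `L`-function of
`V` EXISTS in the tree (`exists_isSplitMultPAdicLFunctionOf`, `exists_isMultPAdicLFunctionOf_neg_one_of_nonsplit`,
Mazur–Tate–Teitelbaum §I.10), so (KV)/(BC) are consumed at it, not assumed inhabited.
[cite: Kato2004Asterisque, Thm. 17.4 (3) (p. 273)] [cite: Wuthrich2014, Thm. 16 (p. 397)]
[cite: BurungaleCastellaSkinner2025, Proof of Thm. 1.1.2 (a) (arXiv:2405.00270v2 p. 10)]
[cite: MazurTateTeitelbaum1986Invent, §I.10, §I.13–I.14] -/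
theorem isTorsion_and_charIdeal_eq_span_branchMult_of_katoV_of_baseChangeLower
    {W : WeierstrassCurve ℚ} (V : WeierstrassCurve ℚ) [V.IsElliptic] [V.IsGloballyMinimal]
    (hV : Mult V p)
    {N : ℕ} [NeZero N] {f : CuspForm (Gamma0 N) 2} (hf : IsNewformOf V f) {ap : ℤ}
    (hap : cuspCoeff f p = ap) {κ : ZpExtension ℚ p} {γ : Field.absoluteGaloisGroup ℚ}
    (hγ : κ.IsTopGenerator γ) (D : W.SelmerDualData κ γ) (ϖ : ℚ)
    (hϖ : if Even (p / 2) then (ϖ : ℝ) * V.realPeriodRat = plusPeriod f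
      else (ϖ : ℝ) * V.imaginaryPeriodRat = minusPeriod f)
    (hbrick : ∀ B : PowerSeries ℚ_[p],
      ((IsOrdinaryAt V p ∧
          B = if Even (p / 2) then padicLFunctionBranch f ((unitRoot V p : ℤ_[p]) : ℚ_[p]) (p / 2)
            else padicLFunctionMinusBranch f ((unitRoot V p : ℤ_[p]) : ℚ_[p]) (p / 2)) ∨
        (V.HasSplitMultiplicativeReductionAtPrime p ∧
          B = if Even (p / 2) then padicLFunctionPlusBranchMult f (1 : ℚ_[p]) (p / 2)
            else padicLFunctionMinusBranchMult f (1 : ℚ_[p]) (p / 2)) ∨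
        (V.HasMultiplicativeReductionAtPrime p ∧ ¬ V.HasSplitMultiplicativeReductionAtPrime p ∧
          B = if Even (p / 2) then padicLFunctionPlusBranchMult f (-1 : ℚ_[p]) (p / 2)
            else padicLFunctionMinusBranchMult f (-1 : ℚ_[p]) (p / 2))) →
      D.IsTorsion ∧ ∃ g ∈ D.charIdeal, ∃ u : ℤ_[p]ˣ,
        iwasawaToPowerSeries p g = PowerSeries.C (((u : ℤ_[p]) : ℚ_[p]) * (ϖ : ℚ_[p])) * B)
    (hKV : ∀ (DV : V.SelmerDualData κ γ) (L : PowerSeries ℚ_[p]),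
      IsMultPAdicLFunctionOf f p ((ap : ℤ) : ℚ_[p]) L →
      ∃ (a : ℕ) (h : IwasawaAlgebra p), h ∈ DV.charIdeal ∧
        iwasawaToPowerSeries p
            (PowerSeries.X ^ (if V.HasSplitMultiplicativeReductionAtPrime p then 1 else 0) * h) =
          PowerSeries.C ((p : ℚ_[p]) ^ a) * L)
    (hBC : ∀ (DV : V.SelmerDualData κ γ) (L : PowerSeries ℚ_[p]),
      IsMultPAdicLFunctionOf f p ((ap : ℤ) : ℚ_[p]) L →
      ∃ (m n : ℕ) (G : IwasawaAlgebra p),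
        iwasawaToPowerSeries p
            (PowerSeries.X ^ (if V.HasSplitMultiplicativeReductionAtPrime p then 1 else 0) * G) =
          PowerSeries.C ((p : ℚ_[p]) ^ n) *
            (L * (if Even (p / 2) then padicLFunctionPlusBranchMult f ((ap : ℤ) : ℚ_[p]) (p / 2)
              else padicLFunctionMinusBranchMult f ((ap : ℤ) : ℚ_[p]) (p / 2))) ∧
        ∀ x ∈ DV.charIdeal, ∀ y ∈ D.charIdeal,
          PowerSeries.C ((p : ℤ_[p]) ^ m) * (x * y) ∈ Ideal.span {G}) :
    D.IsTorsion ∧ ∃ (g : IwasawaAlgebra p) (k : ℤ), D.charIdeal = Ideal.span {g} ∧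
      iwasawaToPowerSeries p g = PowerSeries.C ((p : ℚ_[p]) ^ k * (ϖ : ℚ_[p])) *
        (if Even (p / 2) then padicLFunctionPlusBranchMult f ((ap : ℤ) : ℚ_[p]) (p / 2)
          else padicLFunctionMinusBranchMult f ((ap : ℤ) : ℚ_[p]) (p / 2)) := by
  -- the period ratio is non-zero (`Ω^±_f > 0`)
  have hϖ0 : ϖ ≠ 0 := by
    rintro rfl
    by_cases he : Even (p / 2)
    · rw [if_pos he, Rat.cast_zero, zero_mul] at hϖ
      exact (IsNewform0.plusPeriod_pos_holds hf.1 hf.coeffField_eq_bot).ne hϖ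
    · rw [if_neg he, Rat.cast_zero, zero_mul] at hϖ
      exact (IsNewform0.minusPeriod_pos_holds hf.1 hf.coeffField_eq_bot).ne hϖ
  obtain ⟨DV⟩ := V.nonempty_selmerDualData_holds κ γ hγ
  by_cases hs : V.HasSplitMultiplicativeReductionAtPrime p
  · have hap1 : ap = 1 := by
      have h1 := (hf.cuspCoeff_eq_one_and_sq_of_split hs).1
      rw [hap] at h1
      exact_mod_cast h1
    subst hap1
    obtain ⟨L, hL⟩ := exists_isSplitMultPAdicLFunctionOf hs hf
    have hL' : IsMultPAdicLFunctionOf f p (((1 : ℤ) : ℤ) : ℚ_[p]) L := by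
      rw [Int.cast_one]; exact (isMultPAdicLFunctionOf_one_iff L).mpr hL
    obtain ⟨htors, hKE⟩ := hbrick _ (Or.inr (Or.inl ⟨hs, rfl⟩))
    have hKE' : ∃ g ∈ D.charIdeal, ∃ u : ℤ_[p]ˣ, iwasawaToPowerSeries p g =
        PowerSeries.C (((u : ℤ_[p]) : ℚ_[p]) * (ϖ : ℚ_[p])) *
          (if Even (p / 2) then padicLFunctionPlusBranchMult f (((1 : ℤ) : ℤ) : ℚ_[p]) (p / 2)
            else padicLFunctionMinusBranchMult f (((1 : ℤ) : ℤ) : ℚ_[p]) (p / 2)) := by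
      simpa only [Int.cast_one] using hKE
    exact ⟨htors, (charIdeal_eq_span_branchMult_of_brick_of_katoV_of_baseChangeLower p DV D _ hϖ0 hKE'
      (hKV DV L hL') (hBC DV L hL')).1⟩
  · have hap1 : ap = -1 := by
      have h1 := (hf.cuspCoeff_eq_neg_one_and_dvd_of_nonsplit hV hs).1
      rw [hap] at h1
      exact_mod_cast h1
    subst hap1
    obtain ⟨L, hL⟩ := exists_isMultPAdicLFunctionOf_neg_one_of_nonsplit hf hV hs
    have hL' : IsMultPAdicLFunctionOf f p (((-1 : ℤ) : ℤ) : ℚ_[p]) L := by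
      rw [Int.cast_neg, Int.cast_one]; exact hL
    obtain ⟨htors, hKE⟩ := hbrick _ (Or.inr (Or.inr ⟨hV, hs, rfl⟩))
    have hKE' : ∃ g ∈ D.charIdeal, ∃ u : ℤ_[p]ˣ, iwasawaToPowerSeries p g =
        PowerSeries.C (((u : ℤ_[p]) : ℚ_[p]) * (ϖ : ℚ_[p])) *
          (if Even (p / 2) then padicLFunctionPlusBranchMult f (((-1 : ℤ) : ℤ) : ℚ_[p]) (p / 2)
            else padicLFunctionMinusBranchMult f (((-1 : ℤ) : ℤ) : ℚ_[p]) (p / 2)) := by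
      simpa only [Int.cast_neg, Int.cast_one] using hKE
    exact ⟨htors, (charIdeal_eq_span_branchMult_of_brick_of_katoV_of_baseChangeLower p DV D _ hϖ0 hKE'
      (hKV DV L hL') (hBC DV L hL')).1⟩


end Summit.BirchSwinnertonDyer.BirchSwinnertonDyer.Theorems.AdditiveBranchIMCMultLower

end
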